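import Mathlib
import HarnessLib

/-!
# BalabanUVNodes ∕ N15 — THE KING-MODEL RUNG (PART Ϣ-b): ITERATED FORWARD DIFFERENCES AGAINST DERIVATIVE CHAINS —
# `|Δ_[h]^{j} f₀(θ)| ≤ h^j · sup_{[θ, θ+jh]} |f_j|` whenever `f_{i+1} = f_i′` (the mean-value input of PART Ϣ's four summations by parts on the cycle)
# (Track A, DAG node N15 = NE2; FAN-OUT v1.1 §N15 s3 «KING-MODEL RUNG»; count-neutral)

HONEST FRAMING.  Count-neutral (cell `pub-ymgap`, seat `pub-ymgap-dag-n15-e` g55; `--supports stmt-QuantumFields-27247 --as helper` = K3ᴬ).  Generic one-variable calculus for Mathlib's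
forward-difference operator `fwdDiff h f x = f(x+h) − f(x)` (notation `Δ_[h]`, `Mathlib.Algebra.Group.ForwardDiff`) iterated `j` times, against a DERIVATIVE CHAIN `f : ℕ → ℝ → ℝ`
(`HasDerivAt (f i) (f (i+1) x) x` for `i < N`): no lattice, no field theory.  WHY IT IS HERE: PART Ϣ bounds the cycle heat kernel `K⁻¹Σ_k e^{−s(2−2cos(2πk∕K))}e^{2πikn∕K}` by
four summations by parts on `ℤ∕K`, which turn the sum into `(ψ̄(n)−1)⁻⁴·K⁻¹Σ_k Δ⁴_{2π∕K}[heat(2s)](2πk∕K)·ψ(kn)`; the fourth differences are then bounded by `(2π∕K)⁴` times the supremum of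
the fourth derivative over the window `[θ_k, θ_k + 4·2π∕K]` — this file is that mean-value step, once and for all `j`.
CONTENTS.  ★ `hasDerivAt_fwdDiff` (`(Δ_[h]f)′(x) = Δ_[h]f′(x)`); `hasDerivAt_fwdDiff_chain` (a derivative chain stays a derivative chain under `Δ_[h]`); ★ `abs_fwdDiff_le_of_deriv`
(`|f(ξ+h) − f(ξ)| ≤ h·B` if `|f′| ≤ B` on `[ξ, ξ+h]`, Mathlib `norm_image_sub_le_of_norm_deriv_le_segment'`); ★★ **`abs_iterate_fwdDiff_le_of_chain`** (induction on `j`: for a chain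
`f₀, f₁, …` with `f_{i+1} = f_i′` (`i < N`), `j ≤ N`, `h ≥ 0`: `|Δ_[h]^[j] f₀ (θ)| ≤ h^j·B` whenever `|f_j| ≤ B` on `[θ, θ + j·h]`); periodicity is inherited: `fwdDiff_periodic`,
★ `iterate_fwdDiff_periodic` (`f(x+T) = f(x)` ⟹ `Δ_[h]^[j]f(x+T) = Δ_[h]^[j]f(x)`), `iterate_fwdDiff_add_int_mul`.
PRIOR TREE ART: Mathlib `fwdDiff`, `Function.iterate_succ_apply`, `HasDerivAt.comp_add_const`, `norm_image_sub_le_of_norm_deriv_le_segment'`; the tree's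
`Barriers/CriticalPhenomena/RigorousRGSmallParameterDiscreteTaylor*` files use `fwdDiff` for discrete Taylor bounds on `ℤ` (different object: lattice functions, no derivatives).
Dedup (rg at filing): basename 0 files; needles `hasDerivAt_fwdDiff|abs_iterate_fwdDiff_le_of_chain|iterate_fwdDiff_periodic|hasDerivAt_fwdDiff_chain|abs_fwdDiff_le_of_deriv` 0 tree files.
Locators: the method is [folklore] (finite differences vs. derivatives; [LawlerLimic2010] §2.3 for its use in local limit theorems).  0 `sorry`, 0 `def`.
-/

noncomputable section

open Set fwdDiff

namespace Summit.QuantumFields.YangMills.BalabanUVNodes.N15KingModelRung.HeatKernel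

/-! ## §1 Forward differences of differentiable functions -/

/-- ★ `(Δ_[h]f)′(x) = f′(x+h) − f′(x) = Δ_[h]f′(x)`. [folklore] -/
theorem hasDerivAt_fwdDiff {f f' : ℝ → ℝ} (h : ℝ) {x : ℝ} (h0 : HasDerivAt f (f' x) x) (h1 : HasDerivAt f (f' (x + h)) (x + h)) :
    HasDerivAt (Δ_[h] f) (Δ_[h] f' x) x := by
  have hs : HasDerivAt (fun y => f (y + h)) (f' (x + h)) x := h1.comp_add_const x h
  have := hs.sub h0
  exact this

/-- A derivative chain stays a derivative chain under `Δ_[h]`: if `f_i′ = f_{i+1}` for `i < N` then `(Δ_[h]f_i)′ = Δ_[h]f_{i+1}` for `i < N`. [folklore] -/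
theorem hasDerivAt_fwdDiff_chain {f : ℕ → ℝ → ℝ} {N : ℕ} (hf : ∀ i < N, ∀ x, HasDerivAt (f i) (f (i + 1) x) x) (h : ℝ) :
    ∀ i < N, ∀ x, HasDerivAt (Δ_[h] (f i)) (Δ_[h] (f (i + 1)) x) x :=
  fun i hi x => hasDerivAt_fwdDiff h (hf i hi x) (hf i hi (x + h))

/-- ★ THE MEAN-VALUE STEP: `|f(ξ+h) − f(ξ)| ≤ h·B` if `f′ = g` with `|g| ≤ B` on `[ξ, ξ+h]` (`h ≥ 0`). [folklore] -/
theorem abs_fwdDiff_le_of_deriv {f g : ℝ → ℝ} {ξ h B : ℝ} (hh : 0 ≤ h) (hf : ∀ x ∈ Icc ξ (ξ + h), HasDerivAt f (g x) x)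
    (hB : ∀ x ∈ Icc ξ (ξ + h), |g x| ≤ B) : |Δ_[h] f ξ| ≤ h * B := by
  have hmvt := norm_image_sub_le_of_norm_deriv_le_segment' (f := f) (f' := g) (a := ξ) (b := ξ + h) (C := B)
    (fun x hx => (hf x hx).hasDerivWithinAt) (fun x hx => by
      have := hB x (Ico_subset_Icc_self hx); simpa [Real.norm_eq_abs] using this)
    (ξ + h) (right_mem_Icc.mpr (by linarith))
  have e : ξ + h - ξ = h := by ring
  rw [e, Real.norm_eq_abs] at hmvt
  simpa [fwdDiff, mul_comm] using hmvt

/-! ## §2 Iterated differences against a derivative chain -/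

/-- ★★ **ITERATED FORWARD DIFFERENCES AGAINST A DERIVATIVE CHAIN**: let `f : ℕ → ℝ → ℝ` satisfy `HasDerivAt (f i) (f (i+1) x) x` for all `i < N` and all `x`; then for `j ≤ N`,
`h ≥ 0` and every `θ`: if `|f j| ≤ B` on `[θ, θ + j·h]` then `|Δ_[h]^[j] (f 0) θ| ≤ h^j·B`.  (Induction on `j` for ALL chains at once: `Δ^[j+1]f₀ = Δ^[j](Δf₀)`, the family `Δf_i` is again a
chain, and `|Δf_j| ≤ h·sup|f_{j+1}|` window by window.) [folklore] -/
theorem abs_iterate_fwdDiff_le_of_chain (j : ℕ) :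
    ∀ (f : ℕ → ℝ → ℝ) (N : ℕ), j ≤ N → (∀ i < N, ∀ x, HasDerivAt (f i) (f (i + 1) x) x) →
      ∀ {h : ℝ}, 0 ≤ h → ∀ (θ B : ℝ), (∀ ξ ∈ Icc θ (θ + j * h), |f j ξ| ≤ B) → |(Δ_[h])^[j] (f 0) θ| ≤ h ^ j * B := by
  induction j with
  | zero =>
    intro f N _ _ h _ θ B hB
    simpa using hB θ (by simp)
  | succ j ih =>
    intro f N hjN hf h hh θ B hB
    -- the shifted chain
    set g : ℕ → ℝ → ℝ := fun i => Δ_[h] (f i) with hg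
    have hgchain : ∀ i < N, ∀ x, HasDerivAt (g i) (g (i + 1) x) x := hasDerivAt_fwdDiff_chain hf h
    -- window bound for `g j` from the mean-value step
    have hgj : ∀ ξ ∈ Icc θ (θ + j * h), |g j ξ| ≤ h * B := by
      intro ξ hξ
      have hjlt : j < N := Nat.lt_of_succ_le hjN
      refine abs_fwdDiff_le_of_deriv hh (fun x _ => hf j hjlt x) (fun x hx => hB x ?_)
      constructor
      · exact hξ.1.trans hx.1
      · have := hξ.2; push_cast; nlinarith [hx.2]
    have step := ih g N ((Nat.le_succ j).trans hjN) hgchain hh θ (h * B) hgj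
    rw [Function.iterate_succ_apply]
    calc |(Δ_[h])^[j] (Δ_[h] (f 0)) θ| = |(Δ_[h])^[j] (g 0) θ| := rfl
      _ ≤ h ^ j * (h * B) := step
      _ = h ^ (j + 1) * B := by ring

/-- The case used by PART Ϣ (`j = N = 4`) spelled out: a chain `f₀…f₄` with `f_i′ = f_{i+1}` (`i < 4`) and `|f₄| ≤ B` on `[θ, θ+4h]` gives `|Δ_[h]^[4]f₀(θ)| ≤ h⁴B`. [folklore] -/
theorem abs_iterate_fwdDiff_four_le {f : ℕ → ℝ → ℝ} (hf : ∀ i < 4, ∀ x, HasDerivAt (f i) (f (i + 1) x) x) {h : ℝ} (hh : 0 ≤ h) (θ B : ℝ)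
    (hB : ∀ ξ ∈ Icc θ (θ + 4 * h), |f 4 ξ| ≤ B) : |(Δ_[h])^[4] (f 0) θ| ≤ h ^ 4 * B :=
  abs_iterate_fwdDiff_le_of_chain 4 f 4 le_rfl hf hh θ B (by simpa using hB)

/-! ## §3 Periodicity is inherited by all iterated differences -/

/-- `Δ_[h]` of a `T`-periodic function is `T`-periodic. [folklore] -/
theorem fwdDiff_periodic {f : ℝ → ℝ} {T : ℝ} (hf : Function.Periodic f T) (h : ℝ) : Function.Periodic (Δ_[h] f) T := by
  intro x
  simp only [fwdDiff]
  rw [show x + T + h = (x + h) + T by ring, hf, hf]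

/-- ★ `Δ_[h]^[j]` of a `T`-periodic function is `T`-periodic. [folklore] -/
theorem iterate_fwdDiff_periodic {f : ℝ → ℝ} {T : ℝ} (hf : Function.Periodic f T) (h : ℝ) (j : ℕ) : Function.Periodic ((Δ_[h])^[j] f) T := by
  induction j generalizing f with
  | zero => simpa using hf
  | succ j ih =>
    rw [Function.iterate_succ]
    exact ih (fwdDiff_periodic hf h)

/-- … hence invariant under integer multiples of the period. [folklore] -/
theorem iterate_fwdDiff_add_int_mul {f : ℝ → ℝ} {T : ℝ} (hf : Function.Periodic f T) (h : ℝ) (j : ℕ) (x : ℝ) (m : ℤ) :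
    (Δ_[h])^[j] f (x + m * T) = (Δ_[h])^[j] f x :=
  (iterate_fwdDiff_periodic hf h j).int_mul m x

/-- The successor rule in the form used on the cycle: `Δ_[h]^[j+1]f(x) = Δ_[h]^[j]f(x+h) − Δ_[h]^[j]f(x)`. [folklore] -/
theorem iterate_fwdDiff_succ_apply' (f : ℝ → ℝ) (h : ℝ) (j : ℕ) (x : ℝ) :
    (Δ_[h])^[j + 1] f x = (Δ_[h])^[j] f (x + h) - (Δ_[h])^[j] f x := by
  rw [Function.iterate_succ_apply']
  rfl

end Summit.QuantumFields.YangMills.BalabanUVNodes.N15KingModelRung.HeatKernel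

end
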